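import Mathlib
import Summits.Ventures.PercRepro2.Defs
import Summits.Ventures.PercRepro2.Harris
import Summits.Ventures.PercRepro2.Graph
import Summits.Ventures.PercRepro2.Induced
import Summits.Ventures.PercRepro2.VdBKahn
import Summits.Ventures.PercRepro2.NestIID
import Summits.Ventures.PercRepro2.SideDefs
import Summits.Ventures.PercRepro2.SideLogSupermod
import Summits.Ventures.PercRepro2.WForm

/-!
# The W-inequality of a status law — the typed conjecture of record (blind cell PercRepro2, mine-1 g13)
proofs/MINE1-W-BLOCKS.md §0; MINE1-SIDE.md §0–§1; MINE-1.md §27–§29.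

`statusW p ends s T F` is the status law `W_S = P(C(s) ∩ F = S, C(s) ∩ T = ∅)` as a weight on
`Finset V` (zero outside `2^F`), and `WIneqStatus p ends s T F` is the W-form inequality
`WForm.WIneq` for it with `D` = disjointness of statuses — the cell's W-INEQUALITY for `(G, s, T, F)`
(by `WForm.wIneq_upperSet` / `wIneq_of_upperSets` this is exactly the up-set form
«for all up-sets U and down-sets D′ of 2^F, Σ_{s∈U∖D′, t∈D′∖U, s∩t=∅} W_sW_t ≥ Σ_{s∈U∩D′, t∉U∪D′, s∩t=∅} W_sW_t»
of MINE1-SIDE.md). `WRow` states it for every finite graph, every admissible weight vector, every root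
and every disjoint `(T, F)` — census-true for n ≤ 7 (≈ 2.4·10¹⁰ checks) and open; it is a `Prop`,
not a theorem. Proved here: the status weight is nonnegative, and the inequality holds whenever
`F` has at most one vertex (the two statuses `∅ ⊆ {x}` are comparable).
-/

namespace Summit.Ventures.PercRepro2

section WStatus

variable {V : Type*} {E : Type*} [Fintype E] [DecidableEq E] [Fintype V] [DecidableEq V]
  {R : Type*} [CommRing R] [LinearOrder R] [IsStrictOrderedRing R]

variable (p : E → R) (ends : E → Sym2 V) (s : V) (T F : Finset V)

/-- The status law as a weight on `Finset V`: `P(C ∩ F = S, C ∩ T = ∅)` for `S ⊆ F`, `0` otherwise. -/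
noncomputable def statusW (S : Finset V) : R :=
  if S ⊆ F then statusMass p ends s T F S else 0

/-- The W-inequality for the status law of `(G, s, T, F)`: `WForm.WIneq` with `D` = disjointness. -/
def WIneqStatus : Prop :=
  WForm.WIneq (fun S S' : Finset V => Disjoint S S') (statusW p ends s T F)

/-- The conjecture of record: the W-inequality on every finite graph, for every admissible weight
vector, root, avoided set and test set (`T`, `F` disjoint, `s ∉ F`). -/
def WRow : Prop :=
  ∀ {V : Type} {E : Type} [Fintype E] [DecidableEq E] [Fintype V] [DecidableEq V]
    (p : E → ℚ) (_hp : IsProbVec p) (ends : E → Sym2 V) (s : V) (T F : Finset V),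
    Disjoint T F → s ∉ F → WIneqStatus p ends s T F

variable {p}

omit [Fintype V] in
/-- The status weight is nonnegative. -/
lemma statusW_nonneg (hp : IsProbVec p) (S : Finset V) : 0 ≤ statusW p ends s T F S := by
  unfold statusW
  split_ifs
  · exact prob_nonneg hp _
  · exact le_refl 0

/-- With at most one test vertex every pair of statuses is comparable, so the W-form is a sum of
products of two differences of the same sign: the W-inequality holds. -/
theorem wIneqStatus_of_card_le_one (hp : IsProbVec p) (hF : F.card ≤ 1) :
    WIneqStatus p ends s T F := by
  refine ⟨statusW_nonneg ends s T F hp, ?_⟩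
  intro g h hg hh
  unfold WForm.Q WForm.S
  refine Finset.sum_nonneg fun S _ => Finset.sum_nonneg fun S' _ => ?_
  unfold WForm.coef
  split_ifs with hD
  · -- both statuses are subsets of `F`, hence comparable; a zero weight kills the term otherwise
    by_cases hS : S ⊆ F
    · by_cases hS' : S' ⊆ F
      · have hcomp : S ⊆ S' ∨ S' ⊆ S := by
          rcases Finset.card_le_one.mp hF with hle
          -- `F` has ≤ 1 element: every subset of `F` is `∅` or `F`
          by_cases he : S = ∅
          · left; rw [he]; exact Finset.empty_subset _
          · by_cases he' : S' = ∅
            · right; rw [he']; exact Finset.empty_subset _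
            · left
              intro v hv
              obtain ⟨v', hv'⟩ := Finset.nonempty_iff_ne_empty.mpr he'
              have : v = v' := hle v (hS hv) v' (hS' hv')
              rw [this]; exact hv'
        have hmul : 0 ≤ (g S - g S') * (h S - h S') := by
          rcases hcomp with hc | hc
          · exact mul_nonneg_of_nonpos_of_nonpos (sub_nonpos.mpr (hg hc)) (sub_nonpos.mpr (hh hc))
          · exact mul_nonneg (sub_nonneg.mpr (hg hc)) (sub_nonneg.mpr (hh hc))
        exact mul_nonneg (mul_nonneg (statusW_nonneg ends s T F hp S) (statusW_nonneg ends s T F hp S'))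
          hmul
      · simp only [statusW, if_neg hS', mul_zero, zero_mul, le_refl]
    · simp only [statusW, if_neg hS, zero_mul, le_refl]
  · simp

end WStatus

end Summit.Ventures.PercRepro2
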